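import Literature.AlgebraicGeometry.ComplexMultiplication.CMTypeReducedDegree
import Literature.AlgebraicGeometry.Milne1999.BicommutantFaithful
import Literature.AlgebraicGeometry.Motives.AbelianVarietyCohomologyExteriorH1
import Literature.AlgebraicGeometry.HodgeTheory.AbelianVarietyEndomorphismsHOne
import Literature.RingTheory.CentralSimple.ReducedDegreeBaseChange
import HarnessLib

/-!
# `[K ⊗_ℚ End⁰(A) : K]_red = [End⁰(A) : ℚ]_red ≤ 2 dim A` for a complex abelian variety and every coefficient field
# `K ⊇ ℚ`; complex multiplication read over `K` (Milne, *Complex Multiplication*, Ch. I §1 (1), §3 Prop. 3.1 ∕ Def. 3.2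
# ∕ Prop. 3.3, Ch. II §7 (46))

Family `hodge`, lane `lit-hodgefound` (Track 2 foundations library; skeleton seat `lit-hodgefound-skel-3`, generation 60,
row **A3-G145** «Milne CM Ch. I §1 (1): the reduced degree is invariant under extension of the base field, with its two
printed uses»), layer `Literature/AlgebraicGeometry/ComplexMultiplication`, namespace
`Literature.AlgebraicGeometry.ComplexMultiplication`.  FILE 3 of the row: FILE 1
(`RingTheory/CentralSimple/ReducedDegreeBaseChange`) read on `End⁰(A) = A.endAlgebra` of `A : AbelianVariety ℂ`, joined
BY NAME to A3-G141 FILE 2 (`CMTypeReducedDegree`: `reducedDegree_endAlgebra_le_two_mul_dim`,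
`isOfCMType_iff_reducedDegree_eq` — Def. 3.2 ⟺ the tree's `Milne1999.IsOfCMType`), to Mumford §19 Cor. 2
(`AbelianVariety.isSemisimpleRing_endAlgebra_of_isAlgClosed`: `End⁰(A)` is semisimple — Poincaré), and, for the
printed derivation of (46) through a faithful representation over a bigger coefficient field, to the tree's complex
representation `Milne1999.complexEndAlgebraRepOp : ℂ ⊗_ℚ End⁰(A) → (End_ℂ H¹(A(ℂ); ℂ))ᵒᵖ` and its injectivity
(`Milne1999.complexEndAlgebraRepOp_injective`, Milne 1999 Rem. 1.10) with `b₁ = 2 dim A`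
(`AbelianVariety.finrank_complexBetti_one`).  THEOREMS ONLY (no definition, no instance, no named fact; net debt 0,
D-0026).

## The print

J. S. Milne, *Complex Multiplication* (course notes v0.10, 2020) [MilneCM2006], Ch. I §1 p. 9 display (1) (open text
`paper:url-8ccc30e4daab`, p0009 L28–L29), VERBATIM: «For any field `k'` containing `k`, `[B : k] = [B ⊗_k k' : k']` and
`[B : k]_red = [B ⊗_k k' : k']_red`. (1)»; Ch. I §3 pp. 27–28: «PROPOSITION 3.1 For any abelian variety `A`,
`2 dim A ≥ [End⁰(A) : ℚ]_red`. …  DEFINITION 3.2 … if `2 dim A = [End⁰(A) : ℚ]_red`.  PROPOSITION 3.3 … (a) `A` has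
complex multiplication; (b) `End⁰(A)` contains an étale subalgebra of degree `2 dim A` over `ℚ`; (c) for any Weil
cohomology `X ⇝ H*(X)` with coefficient field `Ω`, the centralizer of `End⁰(A)` in `End_Ω(H¹(A))` is commutative … PROOF.
… (b) ⟹ (c). … then `End⁰(A) ⊗_ℚ Ω` is a product of matrix algebras over fields …»; Ch. II §7 p. 52: «Let `A` be an
abelian variety over a field `k`. If `k` can be embedded in `ℂ`, then `End⁰(A)` acts faithfully on `H₁(A(ℂ), ℚ)`, which
has dimension `2 dim A`, and so (see 1.2), `[End⁰(A) : ℚ]_red ≤ 2 dim A`. (46)  In general, for `ℓ ≠ char k`,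
`End⁰(A) ⊗_ℚ ℚ_ℓ` acts faithfully on `V_ℓA` (e.g., Milne 1986, 12.5), which again implies (46).»

## What is formalised (`A : AbelianVariety ℂ`; `K` any field with `[Algebra ℚ K]`)

* §1 **(1) for `End⁰(A)`**: `reducedDegree_baseChange_endAlgebra` — `[K ⊗_ℚ End⁰(A) : K]_red = [End⁰(A) : ℚ]_red`
  (`End⁰(A)` is semisimple by Poincaré–Mumford §19 Cor. 2; FILE 1's `reducedDegree_baseChange`); hence **PROP. 3.1 over
  every coefficient field** `reducedDegree_baseChange_endAlgebra_le_two_mul_dim` (`[K ⊗_ℚ End⁰(A) : K]_red ≤ 2 dim A`).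
* §2 **(46) AS PRINTED, through a faithful representation over a bigger coefficient field** (with `ℂ` and Betti
  cohomology in place of `ℚ_ℓ` and `V_ℓA`): `reducedDegree_baseChange_complex_endAlgebra_le_finrank_complexBetti`
  (`[ℂ ⊗_ℚ End⁰(A) : ℂ]_red ≤ dim_ℂ H¹(A(ℂ); ℂ)` — `ℂ ⊗_ℚ End⁰(A)` acts faithfully on `H¹(A(ℂ); ℂ)` by `z ⊗ e ↦ z·e^*`,
  Prop. 1.2 over `ℂ`), and «which again implies (46)» `reducedDegree_endAlgebra_le_finrank_complexBetti`
  (`[End⁰(A) : ℚ]_red ≤ [ℂ ⊗_ℚ End⁰(A) : ℂ]_red ≤ dim_ℂ H¹(A(ℂ); ℂ)`, which is `2 dim A` — Milne's p. 52 route to the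
  bound that the tree's `reducedDegree_endAlgebra_le_two_mul_dim` obtains from the rational representation),
  `reducedDegree_baseChange_endAlgebra_le_finrank_complexBetti` (any `K`).
* §3 **DEF. 3.2 ∕ PROP. 3.3 (a) ⟺ (b) over a coefficient field**: `isOfCMType_iff_reducedDegree_baseChange_eq`
  (`A` has complex multiplication iff `[K ⊗_ℚ End⁰(A) : K]_red = 2 dim A`, for one ∕ every `K ⊇ ℚ`),
  **`isOfCMType_iff_exists_comm_isReduced_baseChange`** (iff `K ⊗_ℚ End⁰(A)` contains a commutative reduced = étale
  `K`-subalgebra of degree `2 dim A` — (b) over `Ω`), `finrank_le_two_mul_dim_of_comm_isReduced_baseChange` (every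
  étale `K`-subalgebra of `K ⊗_ℚ End⁰(A)` has degree `≤ 2 dim A` — «`[E : ℚ] ≤ [End⁰(A) : ℚ]_red ≤ 2 dim A`» of Ch. II §7
  over `K`), `reducedDegree_baseChange_endAlgebra_lt_two_mul_dim_iff` (non-CM), and, under CM, a CM-subalgebra
  `S ⊆ End⁰(A)` of degree `2 dim A` base-changes to a MAXIMAL étale `K`-subalgebra `S_K ⊆ K ⊗_ℚ End⁰(A)` of degree
  `2 dim A` (`maximal_range_map_id_val_of_finrank_eq_two_mul_dim`).
* §4 **An algebraically closed coefficient field `Ω`** (FILE 1 §5): `sum_eq_reducedDegree_endAlgebra_of_algEquiv`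
  (`Σᵢ dᵢ = [End⁰(A) : ℚ]_red` for ANY `K ⊗_ℚ End⁰(A) ≃ₐ[K] ∏ᵢ M_{dᵢ}(K)`), `sum_le_two_mul_dim_of_algEquiv`,
  **`isOfCMType_iff_sum_eq_two_mul_dim_of_algEquiv`** (CM ⟺ `Σᵢ dᵢ = 2 dim A` — «`End⁰(A) ⊗_ℚ Ω` is a product of matrix
  algebras over fields and `H¹(A)` is reduced (1.2)» read numerically), `exists_algEquiv_baseChange_endAlgebra_pi_matrix`
  (for `Ω` algebraically closed such a decomposition exists, `Σᵢ dᵢ ≤ 2 dim A`, every `A`),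
  `isOfCMType_iff_exists_algEquiv_baseChange_pi_matrix_sum_eq` and its `ℂ` form
  `isOfCMType_iff_exists_algEquiv_complex_baseChange_pi_matrix_sum_eq`.

## References

* [MilneCM2006] J. S. Milne, *Complex Multiplication* (2006/2020), Ch. I §1 (1), Prop. 1.2 (p. 9); §3 Prop. 3.1,
  Def. 3.2, Prop. 3.3 (pp. 27–28); Ch. II §7 (46) (p. 52).
* [Milne1999LefschetzClasses] J. S. Milne, *Lefschetz classes on abelian varieties*, Duke Math. J. 96 (1999), §1
  p. 642, Rem. 1.10 (the faithful representation of `ℂ ⊗ End⁰(A)` on `H¹(A, ℂ)`).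
* [MumfordAV1970] D. Mumford, *Abelian Varieties* (1970), §19 Cor. 2 of Thm. 1 (p. 174); §1 (3).
-/

noncomputable section

open Module
open scoped TensorProduct

namespace Literature.AlgebraicGeometry.ComplexMultiplication

open Literature.AlgebraicGeometry.Motives Literature.AlgebraicGeometry.HodgeTheory
open Literature.AlgebraicGeometry.Milne1999 (IsOfCMType complexEndAlgebraRepOp complexEndAlgebraRepOp_injective)
open Literature.RingTheory.CentralSimple

/-- `End⁰(A)` is finite-dimensional over `ℚ` (Mumford §19 Cor. 1–2 of Thm. 3; the tree's
`finiteDimensional_endAlgebra_holds`, re-stated on the `Algebra.toModule` structure that the `reducedDegree` lemmas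
elaborate to — as in A3-G141 FILE 2, instance search does not bridge the two `AddCommMonoid` paths of
`endAlgebra.instRing`). [cite: MumfordAV1970, §19 Cor. 1–2 of Thm. 3] -/
private theorem finiteDimensional_endAlgebra₆₀ (B : AbelianVariety ℂ) :
    @FiniteDimensional ℚ B.endAlgebra _ Ring.toAddCommGroup Algebra.toModule :=
  AbelianVariety.finiteDimensional_endAlgebra_holds B

variable (A : AbelianVariety ℂ) (K : Type*) [Field K] [Algebra ℚ K]

/-! ## §1 Milne's (1) for `End⁰(A)`; Prop. 3.1 over every coefficient field -/

/-- **MILNE'S (1) for the endomorphism algebra of a complex abelian variety: `[K ⊗_ℚ End⁰(A) : K]_red = [End⁰(A) : ℚ]_red`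
for every field `K ⊇ ℚ`** (`End⁰(A)` is a finite-dimensional semisimple `ℚ`-algebra — Poincaré's complete reducibility,
Mumford §19 Cor. 2 — and FILE 1's `reducedDegree_baseChange`). [cite: MilneCM2006, Ch. I §1 (1) (p. 9)] [cite: MumfordAV1970, §19 Cor. 2 of Thm. 1 (p. 174)] -/
theorem reducedDegree_baseChange_endAlgebra :
    reducedDegree K (K ⊗[ℚ] A.endAlgebra) = reducedDegree ℚ A.endAlgebra := by
  haveI := finiteDimensional_endAlgebra₆₀ A
  haveI : IsSemisimpleRing A.endAlgebra := AbelianVariety.isSemisimpleRing_endAlgebra_of_isAlgClosed A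
  exact reducedDegree_baseChange K

/-- **PROP. 3.1 over every coefficient field: `[K ⊗_ℚ End⁰(A) : K]_red ≤ 2 dim A`.**
[cite: MilneCM2006, Ch. I §3 Prop. 3.1 (p. 27); §1 (1) (p. 9); Ch. II §7 (46) (p. 52)] -/
theorem reducedDegree_baseChange_endAlgebra_le_two_mul_dim : reducedDegree K (K ⊗[ℚ] A.endAlgebra) ≤ 2 * A.dim := by
  rw [reducedDegree_baseChange_endAlgebra]
  exact reducedDegree_endAlgebra_le_two_mul_dim A

/-- `[End⁰(A) : ℚ]_red ≤ [K ⊗_ℚ End⁰(A) : K]_red` (the semisimplicity-free half of (1), FILE 1 §2).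
[cite: MilneCM2006, Ch. I §1 (1) (p. 9)] -/
theorem reducedDegree_endAlgebra_le_reducedDegree_baseChange :
    reducedDegree ℚ A.endAlgebra ≤ reducedDegree K (K ⊗[ℚ] A.endAlgebra) := by
  haveI := finiteDimensional_endAlgebra₆₀ A
  exact reducedDegree_le_reducedDegree_baseChange K

/-- **The reduced degree of `End⁰(A)` over two coefficient fields agree.** [cite: MilneCM2006, Ch. I §1 (1) (p. 9)] -/
theorem reducedDegree_baseChange_endAlgebra_eq_baseChange (K' : Type*) [Field K'] [Algebra ℚ K'] :
    reducedDegree K (K ⊗[ℚ] A.endAlgebra) = reducedDegree K' (K' ⊗[ℚ] A.endAlgebra) := by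
  rw [reducedDegree_baseChange_endAlgebra, reducedDegree_baseChange_endAlgebra]

/-! ## §2 (46) through the faithful complex representation `ℂ ⊗_ℚ End⁰(A) ↪ (End_ℂ H¹(A(ℂ); ℂ))ᵒᵖ` -/

/-- **(46) over `ℂ`, as printed («`End⁰(A) ⊗_ℚ ℚ_ℓ` acts faithfully on `V_ℓA`, which again implies (46)», with `ℂ`
and `H¹(A(ℂ); ℂ)` for `ℚ_ℓ` and `V_ℓA`): `[ℂ ⊗_ℚ End⁰(A) : ℂ]_red ≤ dim_ℂ H¹(A(ℂ); ℂ)`** — the complex representation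
`z ⊗ e ↦ z·e^*` is injective (the tree's `Milne1999.complexEndAlgebraRepOp_injective`, Milne 1999 Rem. 1.10), so
Prop. 1.2 over `ℂ` applies (FILE 1's `reducedDegree_le_finrank_of_injective_toEnd_mulOpposite`).
[cite: MilneCM2006, Ch. II §7 (46) (p. 52); Ch. I §1 Prop. 1.2 (p. 9)] [cite: Milne1999LefschetzClasses, §1 p. 642 and Rem. 1.10] -/
theorem reducedDegree_baseChange_complex_endAlgebra_le_finrank_complexBetti :
    reducedDegree ℂ (ℂ ⊗[ℚ] A.endAlgebra) ≤ finrank ℂ (complexBetti A.X 1) := by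
  haveI := finiteDimensional_endAlgebra₆₀ A
  haveI : Module.Finite ℂ (complexBetti A.X 1) := finite_complexBetti_abelianVariety A 1
  exact reducedDegree_le_finrank_of_injective_toEnd_mulOpposite (complexEndAlgebraRepOp A)
    complexEndAlgebraRepOp_injective

/-- **«which again implies (46)»: `[End⁰(A) : ℚ]_red ≤ [ℂ ⊗_ℚ End⁰(A) : ℂ]_red ≤ dim_ℂ H¹(A(ℂ); ℂ)` (`= 2 dim A`,
`AbelianVariety.finrank_complexBetti_one`)** — Milne's Ch. II §7 route to Prop. 3.1 (FILE 1 §2 and the faithful complex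
representation above); the tree's `reducedDegree_endAlgebra_le_two_mul_dim` is the same bound through the rational
representation on `H¹(A(ℂ); ℚ)`. [cite: MilneCM2006, Ch. II §7 (46) (p. 52); Ch. I §1 (1) (p. 9)] [cite: MumfordAV1970, §1 (3)] -/
theorem reducedDegree_endAlgebra_le_finrank_complexBetti :
    reducedDegree ℚ A.endAlgebra ≤ finrank ℂ (complexBetti A.X 1) :=
  (reducedDegree_endAlgebra_le_reducedDegree_baseChange A ℂ).trans
    (reducedDegree_baseChange_complex_endAlgebra_le_finrank_complexBetti A)

/-- `[K ⊗_ℚ End⁰(A) : K]_red ≤ dim_ℂ H¹(A(ℂ); ℂ)` for every coefficient field `K` (both sides equal to `[End⁰(A) : ℚ]_red`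
resp. `2 dim A`). [cite: MilneCM2006, Ch. II §7 (46) (p. 52); Ch. I §1 (1) (p. 9)] -/
theorem reducedDegree_baseChange_endAlgebra_le_finrank_complexBetti :
    reducedDegree K (K ⊗[ℚ] A.endAlgebra) ≤ finrank ℂ (complexBetti A.X 1) := by
  rw [reducedDegree_baseChange_endAlgebra_eq_baseChange A K ℂ]
  exact reducedDegree_baseChange_complex_endAlgebra_le_finrank_complexBetti A

/-! ## §3 Def. 3.2 and Prop. 3.3 (a) ⟺ (b) over a coefficient field -/

/-- **DEF. 3.2 over any coefficient field: `A` has complex multiplication (the tree's `Milne1999.IsOfCMType`) iff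
`[K ⊗_ℚ End⁰(A) : K]_red = 2 dim A`** — for one, equivalently every, field `K ⊇ ℚ` (Def. 3.2 is
`isOfCMType_iff_reducedDegree_eq`; (1) moves it to `K`). [cite: MilneCM2006, Ch. I §3 Def. 3.2 (p. 27); §1 (1) (p. 9)] -/
theorem isOfCMType_iff_reducedDegree_baseChange_eq :
    IsOfCMType A ↔ reducedDegree K (K ⊗[ℚ] A.endAlgebra) = 2 * A.dim := by
  rw [reducedDegree_baseChange_endAlgebra, isOfCMType_iff_reducedDegree_eq]

/-- **PROP. 3.3 (a) ⟺ (b) over a coefficient field `Ω = K`: `A` has complex multiplication iff `K ⊗_ℚ End⁰(A)` contains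
a commutative reduced (étale) `K`-subalgebra of degree `2 dim A`** — for `K = Ω` algebraically closed: iff
`End⁰(A) ⊗ Ω ⊇ Ω^{2 dim A}`, the form behind «then `End⁰(A) ⊗_ℚ Ω` is a product of matrix algebras over fields».
[cite: MilneCM2006, Ch. I §3 Prop. 3.3 (a) ⟺ (b) and proof of (b) ⟹ (c) (pp. 27–28); §1 (1) (p. 9)] -/
theorem isOfCMType_iff_exists_comm_isReduced_baseChange :
    IsOfCMType A ↔
      ∃ S : Subalgebra K (K ⊗[ℚ] A.endAlgebra), (∀ x ∈ S, ∀ y ∈ S, x * y = y * x) ∧ IsReduced S ∧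
        finrank K S = 2 * A.dim := by
  haveI := finiteDimensional_endAlgebra₆₀ A
  rw [isOfCMType_iff_reducedDegree_baseChange_eq A K]
  exact reducedDegree_eq_iff_exists_of_le (reducedDegree_baseChange_endAlgebra_le_two_mul_dim A K)

/-- **Every commutative reduced `K`-subalgebra of `K ⊗_ℚ End⁰(A)` has degree `≤ 2 dim A`** (Ch. II §7 «`[E : ℚ] ≤(1.3)
[End⁰(A) : ℚ]_red ≤(46) 2 dim A`», over the coefficient field `K`). [cite: MilneCM2006, Ch. II §7 (p. 52); Ch. I §1 (1), Prop. 1.3 (p. 9)] -/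
theorem finrank_le_two_mul_dim_of_comm_isReduced_baseChange (S : Subalgebra K (K ⊗[ℚ] A.endAlgebra))
    (hcomm : ∀ x ∈ S, ∀ y ∈ S, x * y = y * x) [IsReduced S] : finrank K S ≤ 2 * A.dim := by
  haveI := finiteDimensional_endAlgebra₆₀ A
  exact (finrank_le_reducedDegree S hcomm).trans (reducedDegree_baseChange_endAlgebra_le_two_mul_dim A K)

/-- Non-CM abelian varieties are exactly those with `[K ⊗_ℚ End⁰(A) : K]_red < 2 dim A` (any `K ⊇ ℚ`).
[cite: MilneCM2006, Ch. I §3 Prop. 3.1, Def. 3.2 (p. 27); §1 (1) (p. 9)] -/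
theorem reducedDegree_baseChange_endAlgebra_lt_two_mul_dim_iff :
    reducedDegree K (K ⊗[ℚ] A.endAlgebra) < 2 * A.dim ↔ ¬ IsOfCMType A := by
  rw [reducedDegree_baseChange_endAlgebra, reducedDegree_lt_two_mul_dim_iff]

variable {A} in
/-- **Under CM, a CM-subalgebra `S ⊆ End⁰(A)` (commutative reduced of degree `2 dim A`) base-changes to a MAXIMAL étale
`K`-subalgebra `S_K ⊆ K ⊗_ℚ End⁰(A)`, of degree `2 dim A`** (`S` is maximal étale of degree `[End⁰(A) : ℚ]_red`, Prop. 1.3;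
FILE 1's `maximal_range_map_id_val_of_maximal` and p38's `finrank_range_map_id_val`).
[cite: MilneCM2006, Ch. I §1 (1), Prop. 1.3 (p. 9); §3 Prop. 3.3 (pp. 27–28)] -/
theorem maximal_range_map_id_val_of_finrank_eq_two_mul_dim (S : Subalgebra ℚ A.endAlgebra)
    (hcomm : ∀ x ∈ S, ∀ y ∈ S, x * y = y * x) [IsReduced S] (hS : finrank ℚ S = 2 * A.dim) :
    Maximal (fun M : Subalgebra K (K ⊗[ℚ] A.endAlgebra) => (∀ x ∈ M, ∀ y ∈ M, x * y = y * x) ∧ IsReduced M)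
        (Algebra.TensorProduct.map (AlgHom.id K K) S.val).range ∧
      finrank K ↥(Algebra.TensorProduct.map (AlgHom.id K K) S.val).range = 2 * A.dim := by
  haveI := finiteDimensional_endAlgebra₆₀ A
  haveI : IsSemisimpleRing A.endAlgebra := AbelianVariety.isSemisimpleRing_endAlgebra_of_isAlgClosed A
  exact ⟨maximal_range_map_id_val_of_maximal K S (maximal_of_finrank_eq_two_mul_dim A S hcomm hS),
    (finrank_range_map_id_val K S).trans hS⟩

/-! ## §4 An algebraically closed coefficient field: `Ω ⊗_ℚ End⁰(A) ≃ ∏ᵢ M_{dᵢ}(Ω)`, and CM ⟺ `Σᵢ dᵢ = 2 dim A` -/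

/-- **`Σᵢ dᵢ = [End⁰(A) : ℚ]_red` for ANY decomposition `K ⊗_ℚ End⁰(A) ≃ₐ[K] ∏ᵢ M_{dᵢ}(K)`** (any field `K ⊇ ℚ`; (1) and
(1.2) over `K`). [cite: MilneCM2006, Ch. I §1 (1), (1.2) (pp. 8–9); §3 proof of Prop. 3.3 (p. 28)] -/
theorem sum_eq_reducedDegree_endAlgebra_of_algEquiv {ι : Type*} [Fintype ι] {d : ι → ℕ}
    (e : K ⊗[ℚ] A.endAlgebra ≃ₐ[K] Π i, Matrix (Fin (d i)) (Fin (d i)) K) : ∑ i, d i = reducedDegree ℚ A.endAlgebra := by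
  haveI := finiteDimensional_endAlgebra₆₀ A
  haveI : IsSemisimpleRing A.endAlgebra := AbelianVariety.isSemisimpleRing_endAlgebra_of_isAlgClosed A
  exact sum_eq_reducedDegree_of_algEquiv_baseChange_pi_matrix K e

/-- **`Σᵢ dᵢ ≤ 2 dim A` for any `K ⊗_ℚ End⁰(A) ≃ₐ[K] ∏ᵢ M_{dᵢ}(K)`** (Prop. 3.1 over `K`).
[cite: MilneCM2006, Ch. I §3 Prop. 3.1 (p. 27); §1 (1) (p. 9)] -/
theorem sum_le_two_mul_dim_of_algEquiv {ι : Type*} [Fintype ι] {d : ι → ℕ}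
    (e : K ⊗[ℚ] A.endAlgebra ≃ₐ[K] Π i, Matrix (Fin (d i)) (Fin (d i)) K) : ∑ i, d i ≤ 2 * A.dim := by
  rw [sum_eq_reducedDegree_endAlgebra_of_algEquiv A K e]
  exact reducedDegree_endAlgebra_le_two_mul_dim A

/-- **DEF. 3.2 over a splitting coefficient field: if `K ⊗_ℚ End⁰(A) ≃ₐ[K] ∏ᵢ M_{dᵢ}(K)`, then `A` has complex
multiplication iff `Σᵢ dᵢ = 2 dim A`** — Milne's «then `End⁰(A) ⊗_ℚ Ω` is a product of matrix algebras over fields and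
`H¹(A)` is reduced (1.2)» read numerically: `dim_Ω H¹(A) = 2 dim A` against `[End⁰(A) ⊗ Ω : Ω]_red = Σᵢ dᵢ`.
[cite: MilneCM2006, Ch. I §3 Def. 3.2 and proof of Prop. 3.3 (pp. 27–28); §1 (1), (1.2), Prop. 1.2 (pp. 8–9)] -/
theorem isOfCMType_iff_sum_eq_two_mul_dim_of_algEquiv {ι : Type*} [Fintype ι] {d : ι → ℕ}
    (e : K ⊗[ℚ] A.endAlgebra ≃ₐ[K] Π i, Matrix (Fin (d i)) (Fin (d i)) K) : IsOfCMType A ↔ ∑ i, d i = 2 * A.dim := by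
  rw [isOfCMType_iff_reducedDegree_eq, sum_eq_reducedDegree_endAlgebra_of_algEquiv A K e]

/-- **For `Ω ⊇ ℚ` algebraically closed (e.g. `Ω = ℂ`, `ℚ̄`): `Ω ⊗_ℚ End⁰(A) ≃ₐ[Ω] ∏ᵢ M_{dᵢ}(Ω)` with `dᵢ ≥ 1`,
`Σᵢ dᵢ = [End⁰(A) : ℚ]_red ≤ 2 dim A`** — for every complex abelian variety («`B ⊗_ℚ K ≈ ∏ M_n(K)` for `K` containing
all conjugates of `k` and splitting `B`», p. 8; Poincaré–Mumford §19 Cor. 2, Pierce §10.7, Wedderburn–Artin over `Ω`).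
[cite: MilneCM2006, Ch. I §1 pp. 8–9, (1); §3 Prop. 3.1 (p. 27)] [cite: MumfordAV1970, §19 Cor. 2 of Thm. 1 (p. 174)] -/
theorem exists_algEquiv_baseChange_endAlgebra_pi_matrix [IsAlgClosed K] :
    ∃ (n : ℕ) (d : Fin n → ℕ), (∀ i, NeZero (d i)) ∧
      Nonempty (K ⊗[ℚ] A.endAlgebra ≃ₐ[K] Π i, Matrix (Fin (d i)) (Fin (d i)) K) ∧
        ∑ i, d i = reducedDegree ℚ A.endAlgebra ∧ ∑ i, d i ≤ 2 * A.dim := by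
  haveI := finiteDimensional_endAlgebra₆₀ A
  haveI : IsSemisimpleRing A.endAlgebra := AbelianVariety.isSemisimpleRing_endAlgebra_of_isAlgClosed A
  obtain ⟨n, d, hd, ⟨e⟩, hsum⟩ := exists_algEquiv_baseChange_pi_matrix_sum_eq_reducedDegree K (F := ℚ) (B := A.endAlgebra)
  exact ⟨n, d, hd, ⟨e⟩, hsum, sum_le_two_mul_dim_of_algEquiv A K e⟩

/-- **CM ⟺ `Ω ⊗_ℚ End⁰(A) ≃ ∏ᵢ M_{dᵢ}(Ω)` for some `dᵢ` with `Σᵢ dᵢ = 2 dim A`** (`Ω ⊇ ℚ` algebraically closed).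
[cite: MilneCM2006, Ch. I §3 Def. 3.2, proof of Prop. 3.3 (pp. 27–28); §1 (1), (1.2) (pp. 8–9)] -/
theorem isOfCMType_iff_exists_algEquiv_baseChange_pi_matrix_sum_eq [IsAlgClosed K] :
    IsOfCMType A ↔ ∃ (n : ℕ) (d : Fin n → ℕ),
      Nonempty (K ⊗[ℚ] A.endAlgebra ≃ₐ[K] Π i, Matrix (Fin (d i)) (Fin (d i)) K) ∧ ∑ i, d i = 2 * A.dim := by
  haveI := finiteDimensional_endAlgebra₆₀ A
  haveI : IsSemisimpleRing A.endAlgebra := AbelianVariety.isSemisimpleRing_endAlgebra_of_isAlgClosed A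
  rw [isOfCMType_iff_reducedDegree_eq]
  exact reducedDegree_eq_iff_exists_algEquiv_baseChange_pi_matrix K

/-- **Over `ℂ`: `A` has complex multiplication iff `ℂ ⊗_ℚ End⁰(A) ≃ₐ[ℂ] ∏ᵢ M_{dᵢ}(ℂ)` with `Σᵢ dᵢ = 2 dim A`** (e.g. an
elliptic curve: `End⁰ ⊗ ℂ = ℂ`, `Σ dᵢ = 1 < 2`, versus `K ⊗ ℂ = ℂ × ℂ`, `Σ dᵢ = 2`, for `K` imaginary quadratic).
[cite: MilneCM2006, Ch. I §3 Def. 3.2, proof of Prop. 3.3 and Example 3.4 (pp. 27–28); §1 (1) (p. 9)] -/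
theorem isOfCMType_iff_exists_algEquiv_complex_baseChange_pi_matrix_sum_eq :
    IsOfCMType A ↔ ∃ (n : ℕ) (d : Fin n → ℕ),
      Nonempty (ℂ ⊗[ℚ] A.endAlgebra ≃ₐ[ℂ] Π i, Matrix (Fin (d i)) (Fin (d i)) ℂ) ∧ ∑ i, d i = 2 * A.dim :=
  isOfCMType_iff_exists_algEquiv_baseChange_pi_matrix_sum_eq A ℂ

end Literature.AlgebraicGeometry.ComplexMultiplication
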